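import Literature.Analysis.FluidPDE.OseenDuhamelEnvelopeCalculus
import Literature.Analysis.FluidPDE.NSBoundedMildOseenRestart
import HarnessLib

/-!
# The restart law of the Oseen–Duhamel term of a pair under a slice-wise envelope

Analysis/FluidPDE support file (everything proved) for the perturbation step of M. P. Coiculescu,
S. Palasek, *Non-uniqueness of smooth solutions of the Navier–Stokes equations from critical data*,
Invent. Math. 244 (2025) = arXiv:2503.14699, §5 ¶1 ("by standard regularity theory, `u⁽ⁱ⁾` is in
fact smooth"): to feed the correction `w` of Prop. 4.3, built from the base time `0` with
time-singular coefficients (`‖v(τ)‖ ≲ τ^{-1/2}`, `‖F(τ)‖ ≲ τ^{α-1}`), into the bounded mild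
theory of Koch–Nadirashvili–Seregin–Šverák on windows `(s, T]`, `s > 0`, one needs the restart
(semigroup) law of the Duhamel term `B¹_{s₀}(a,b)(t) = ∫_{s₀}^t e^{(t-τ)Δ}ℙ∇·(a ⊗ b) dτ` for pairs of
fields that are only bounded slice-wise by an envelope with `(s-τ)^{-1/2} M_a(τ) M_b(τ)`
integrable. This file proves it (the tree's `heatExtension_oseenDuhamel_eq_setIntegral`, KNSS 2009
§4 p. 8, is the case `a = b` bounded):

* `exists_integrable_oseenKernel_slab_of_envelope` — the Duhamel integrand of a pair under an
  envelope is integrable on the slab `(s₀, s₁) × E`, with `∫∫‖·‖` bounded uniformly in the base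
  point;
* `heatExtension_oseenDuhamel_eq_setIntegral_of_envelope` —
  `e^{(t-s)Δ}[B¹_{s₀}(a,b)(s)](x) = ∫_{(s₀,s)} N_{t-τ}[a τ, b τ](x) dτ` for `s₀ < s < t`;
* `oseenDuhamel_eq_heatExtension_add_of_envelope` — the restart law
  `B¹_{s₀}(a,b)(t)(x) = e^{(t-s)Δ}[B¹_{s₀}(a,b)(s)](x) + B¹_s(a,b)(t)(x)`.

## References

* G. Koch, N. Nadirashvili, G. Seregin, V. Šverák, Acta Math. 203 (2009) = arXiv:0709.3599, §4
  p. 8 (`u = U + B(u,u)` "as an ODE in `t`"). [`KochNadirashviliSereginSverak2009`]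
* M. P. Coiculescu, S. Palasek, Invent. Math. 244 (2025) = arXiv:2503.14699, §5 ¶1 and proof of
  Prop. 4.3 (Duhamel formula for `w`). [`CoiculescuPalasek2025`]
-/

noncomputable section

open MeasureTheory Set Function Filter TopologicalSpace InnerProductSpace Metric
open _root_.Topology
open scoped RealInnerProductSpace NNReal ENNReal

namespace Literature.Analysis.FluidPDE

variable {E : Type*} [NormedAddCommGroup E] [InnerProductSpace ℝ E] [FiniteDimensional ℝ E]
  [MeasurableSpace E] [BorelSpace E]

variable {a b : ℝ → E → E} {Ma Mb : ℝ → ℝ}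

/-- **The Duhamel integrand of a pair under an envelope is integrable on a time slab**, with
`∫∫‖K(t-τ, z-y)[a(τ,y), b(τ,y)]‖ dy dτ ≤ B` uniformly in `z`: for jointly measurable `a, b` with
`‖a τ y‖ ≤ M_a(τ)`, `‖b τ y‖ ≤ M_b(τ)` on `(s₀, s₁)`, `s₀ < s₁ ≤ t`, and
`(t-τ)^{-1/2} M_a(τ) M_b(τ)` integrable on `(s₀, s₁)` (Tonelli under Koch–Tataru's pointwise
bound `‖K(σ,z)[a,b]‖ ≤ C(σ + |z|²)^{-(d+1)/2}|a||b|`). [cite: KochNadirashviliSereginSverak2009, §4 p. 8, the estimate for B (arXiv:0709.3599)] -/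
theorem exists_integrable_oseenKernel_slab_of_envelope (ham : Measurable (uncurry a))
    (hbm : Measurable (uncurry b)) {s₀ s₁ t : ℝ} (hst : s₁ ≤ t)
    (ha : ∀ τ ∈ Ioo s₀ s₁, ∀ y, ‖a τ y‖ ≤ Ma τ) (hb : ∀ τ ∈ Ioo s₀ s₁, ∀ y, ‖b τ y‖ ≤ Mb τ)
    (henv : IntegrableOn (fun τ => (t - τ) ^ (-(1 / 2 : ℝ)) * (Ma τ * Mb τ)) (Ioo s₀ s₁)) :
    ∃ B : ℝ, 0 ≤ B ∧ ∀ z : E,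
      Integrable (fun p : ℝ × E => oseenKernel (t - p.1) (z - p.2) (a p.1 p.2) (b p.1 p.2))
          (((volume : Measure ℝ).restrict (Ioo s₀ s₁)).prod (volume : Measure E)) ∧
        ∫ p, ‖oseenKernel (t - p.1) (z - p.2) (a p.1 p.2) (b p.1 p.2)‖
            ∂(((volume : Measure ℝ).restrict (Ioo s₀ s₁)).prod (volume : Measure E)) ≤ B := by
  obtain ⟨C, hC, hK⟩ := exists_norm_oseenKernel_le (E := E)
  set dd : ℝ := (Module.finrank ℝ E : ℝ) with hdd
  set I : ℝ := ∫ w : E, (1 + ‖w‖ ^ 2) ^ (-((dd + 1) / 2)) with hI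
  have hI0 : 0 < I := integral_one_add_norm_sq_rpow_neg_pos (by linarith)
  have hMa0 : ∀ τ ∈ Ioo s₀ s₁, 0 ≤ Ma τ := fun τ hτ => (norm_nonneg _).trans (ha τ hτ 0)
  have hMb0 : ∀ τ ∈ Ioo s₀ s₁, 0 ≤ Mb τ := fun τ hτ => (norm_nonneg _).trans (hb τ hτ 0)
  have henv0 : 0 ≤ ∫ τ in Ioo s₀ s₁, (t - τ) ^ (-(1 / 2 : ℝ)) * (Ma τ * Mb τ) :=
    setIntegral_nonneg measurableSet_Ioo fun τ hτ =>
      mul_nonneg (Real.rpow_nonneg (by linarith [hτ.2]) _) (mul_nonneg (hMa0 τ hτ) (hMb0 τ hτ))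
  set B : ℝ := C * I * ∫ τ in Ioo s₀ s₁, (t - τ) ^ (-(1 / 2 : ℝ)) * (Ma τ * Mb τ) with hB
  have hB0 : 0 ≤ B := by positivity
  refine ⟨B, hB0, fun z => ?_⟩
  set μ : Measure (ℝ × E) := ((volume : Measure ℝ).restrict (Ioo s₀ s₁)).prod volume with hμ
  set F : ℝ × E → E := fun p => oseenKernel (t - p.1) (z - p.2) (a p.1 p.2) (b p.1 p.2) with hF
  have hFm : Measurable F :=
    Measurable.oseenKernel_comp (measurable_const.sub measurable_fst)
      (measurable_const.sub measurable_snd) ham hbm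
  -- slice bounds: `∫ ‖F(τ, y)‖ dy ≤ C I (t-τ)^{-1/2} M_a(τ) M_b(τ)`
  have hslice_int : ∀ τ ∈ Ioo s₀ s₁, Integrable (fun y => F (τ, y)) volume := fun τ hτ =>
    integrable_oseenKernel_slice_of_bound (sub_pos.2 (hτ.2.trans_le hst))
      ham.of_uncurry_left.aestronglyMeasurable hbm.of_uncurry_left.aestronglyMeasurable
      (ha τ hτ) (hb τ hτ) z
  have hslice_le : ∀ τ ∈ Ioo s₀ s₁, ∫ y, ‖F (τ, y)‖ ≤
      C * I * ((t - τ) ^ (-(1 / 2 : ℝ)) * (Ma τ * Mb τ)) := by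
    intro τ hτ
    have hσ : 0 < t - τ := sub_pos.2 (hτ.2.trans_le hst)
    have hw := ((integrable_add_norm_sq_rpow_neg_half_succ (E := E) hσ).comp_sub_left z).const_mul
      (C * Ma τ * Mb τ)
    calc ∫ y, ‖F (τ, y)‖
        ≤ ∫ y, C * Ma τ * Mb τ * (t - τ + ‖z - y‖ ^ 2) ^ (-((dd + 1) / 2)) :=
          integral_mono_of_nonneg (Eventually.of_forall fun y => norm_nonneg _) hw
            (Eventually.of_forall fun y =>
              norm_oseenKernel_apply_le_weight hK hC.le hσ (ha τ hτ) (hb τ hτ) z y)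
      _ = C * Ma τ * Mb τ * ((t - τ) ^ (-(1 / 2 : ℝ)) * I) := by
          rw [integral_const_mul]
          have h1 := integral_sub_left_eq_self
            (fun w : E => (t - τ + ‖w‖ ^ 2) ^ (-((dd + 1) / 2))) volume z
          rw [h1, integral_add_norm_sq_rpow_neg_half_succ hσ]
      _ = C * I * ((t - τ) ^ (-(1 / 2 : ℝ)) * (Ma τ * Mb τ)) := by ring
  have hGm : AEStronglyMeasurable (fun τ => ∫ y, ‖F (τ, y)‖ ∂(volume : Measure E))
      ((volume : Measure ℝ).restrict (Ioo s₀ s₁)) :=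
    hFm.aestronglyMeasurable.norm.integral_prod_right'
  have hGint : Integrable (fun τ => ∫ y, ‖F (τ, y)‖ ∂(volume : Measure E))
      ((volume : Measure ℝ).restrict (Ioo s₀ s₁)) := by
    refine (henv.const_mul (C * I)).mono' hGm ?_
    filter_upwards [ae_restrict_mem measurableSet_Ioo] with τ hτ
    rw [Real.norm_of_nonneg (integral_nonneg fun y => norm_nonneg _)]
    exact hslice_le τ hτ
  have hint : Integrable F μ := by
    rw [hμ, integrable_prod_iff hFm.aestronglyMeasurable]
    refine ⟨?_, hGint⟩
    filter_upwards [ae_restrict_mem measurableSet_Ioo] with τ hτ using hslice_int τ hτ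
  refine ⟨hint, ?_⟩
  rw [hμ, integral_prod _ hint.norm]
  calc ∫ τ in Ioo s₀ s₁, ∫ y, ‖F (τ, y)‖
      ≤ ∫ τ in Ioo s₀ s₁, C * I * ((t - τ) ^ (-(1 / 2 : ℝ)) * (Ma τ * Mb τ)) := by
        refine integral_mono_ae hGint (henv.const_mul (C * I)) ?_
        filter_upwards [ae_restrict_mem measurableSet_Ioo] with τ hτ using hslice_le τ hτ
    _ = B := by rw [integral_const_mul]

/-- The envelope at a later time is dominated by the envelope at the earlier time:
`(t-τ)^{-1/2} ≤ (s-τ)^{-1/2}` for `τ < s ≤ t`, hence integrability on `(s₀, s)` transfers. [folklore] -/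
theorem integrableOn_envelope_mono_time {s₀ s t : ℝ} (hst : s ≤ t)
    (hMa : ∀ τ ∈ Ioo s₀ s, 0 ≤ Ma τ) (hMb : ∀ τ ∈ Ioo s₀ s, 0 ≤ Mb τ)
    (hm : AEStronglyMeasurable (fun τ => Ma τ * Mb τ) ((volume : Measure ℝ).restrict (Ioo s₀ s)))
    (henv : IntegrableOn (fun τ => (s - τ) ^ (-(1 / 2 : ℝ)) * (Ma τ * Mb τ)) (Ioo s₀ s)) :
    IntegrableOn (fun τ => (t - τ) ^ (-(1 / 2 : ℝ)) * (Ma τ * Mb τ)) (Ioo s₀ s) := by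
  have hkm : AEStronglyMeasurable (fun τ : ℝ => (t - τ) ^ (-(1 / 2 : ℝ)))
      ((volume : Measure ℝ).restrict (Ioo s₀ s)) :=
    (measurable_id.const_sub t).pow_const _ |>.aestronglyMeasurable
  refine Integrable.mono' henv (hkm.mul hm) ?_
  filter_upwards [ae_restrict_mem measurableSet_Ioo] with τ hτ
  have h1 : 0 < s - τ := sub_pos.2 hτ.2
  have h2 : (t - τ) ^ (-(1 / 2 : ℝ)) ≤ (s - τ) ^ (-(1 / 2 : ℝ)) :=
    Real.rpow_le_rpow_of_nonpos h1 (by linarith) (by norm_num)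
  have h3 : 0 ≤ Ma τ * Mb τ := mul_nonneg (hMa τ hτ) (hMb τ hτ)
  rw [Real.norm_of_nonneg (mul_nonneg (Real.rpow_nonneg (by linarith [hτ.2]) _) h3)]
  exact mul_le_mul_of_nonneg_right h2 h3

/-- **The heat flow of a Duhamel piece shifts its kernel times, pair/envelope form**: for
jointly measurable `a, b` with an envelope on `(s₀, s)` such that `(s-τ)^{-1/2}M_a(τ)M_b(τ)` is
integrable there, and `s < t`,
`e^{(t-s)Δ}[B¹_{s₀}(a,b)(s)](x) = ∫_{(s₀,s)} N_{t-τ}[a τ, b τ](x) dτ` (the semigroup law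
`e^{(t-s)Δ}K(s-τ) = K(t-τ)` under the integral sign; Fubini on `E × ((s₀,s) × E)`). The tree's
`heatExtension_oseenDuhamel_eq_setIntegral` (KNSS 2009, §4 p. 8) is the bounded diagonal case. [cite: KochNadirashviliSereginSverak2009, §4 p. 8 (arXiv:0709.3599)] -/
theorem heatExtension_oseenDuhamel_eq_setIntegral_of_envelope (ham : Measurable (uncurry a))
    (hbm : Measurable (uncurry b)) {s₀ s t : ℝ} (hst : s < t)
    (ha : ∀ τ ∈ Ioo s₀ s, ∀ y, ‖a τ y‖ ≤ Ma τ) (hb : ∀ τ ∈ Ioo s₀ s, ∀ y, ‖b τ y‖ ≤ Mb τ)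
    (hm : AEStronglyMeasurable (fun τ => Ma τ * Mb τ) ((volume : Measure ℝ).restrict (Ioo s₀ s)))
    (henv : IntegrableOn (fun τ => (s - τ) ^ (-(1 / 2 : ℝ)) * (Ma τ * Mb τ)) (Ioo s₀ s)) (x : E) :
    UnboundedOperators.heatExtension (oseenDuhamel 1 s₀ a b s) (t - s) x =
      ∫ τ in Ioo s₀ s, oseenSlice (t - τ) (a τ) (b τ) x := by
  set μ : Measure (ℝ × E) := ((volume : Measure ℝ).restrict (Ioo s₀ s)).prod volume with hμ
  have hts : 0 < t - s := sub_pos.2 hst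
  have hMa0 : ∀ τ ∈ Ioo s₀ s, 0 ≤ Ma τ := fun τ hτ => (norm_nonneg _).trans (ha τ hτ 0)
  have hMb0 : ∀ τ ∈ Ioo s₀ s, 0 ≤ Mb τ := fun τ hτ => (norm_nonneg _).trans (hb τ hτ 0)
  have henv_t : IntegrableOn (fun τ => (t - τ) ^ (-(1 / 2 : ℝ)) * (Ma τ * Mb τ)) (Ioo s₀ s) :=
    integrableOn_envelope_mono_time hst.le hMa0 hMb0 hm henv
  -- the Duhamel term at time `s` as a product integral, at every base point
  obtain ⟨B, hB0, hB⟩ := exists_integrable_oseenKernel_slab_of_envelope ham hbm le_rfl ha hb henv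
  have hD : ∀ z, oseenDuhamel 1 s₀ a b s z =
      ∫ p, oseenKernel (s - p.1) (z - p.2) (a p.1 p.2) (b p.1 p.2) ∂μ := fun z => by
    rw [oseenDuhamel_apply, hμ, integral_prod _ (hB z).1]
    refine setIntegral_congr_fun measurableSet_Ioo fun τ _ => ?_
    simp only [one_mul]
  -- the triple integrand and its integrability on `E × ((s₀, s) × E)`
  set H : E → ℝ × E → E := fun y' p => UnboundedOperators.heatKernel (t - s) y' •
    oseenKernel (s - p.1) (x - y' - p.2) (a p.1 p.2) (b p.1 p.2) with hH
  have hHm : Measurable (uncurry H) := by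
    refine ((UnboundedOperators.continuous_heatKernel _).measurable.comp measurable_fst).smul ?_
    exact Measurable.oseenKernel_comp (measurable_const.sub measurable_snd.fst)
      ((measurable_const.sub measurable_fst).sub measurable_snd.snd) (ham.comp measurable_snd)
      (hbm.comp measurable_snd)
  have hHint : Integrable (uncurry H) ((volume : Measure E).prod μ) := by
    refine (integrable_prod_iff hHm.aestronglyMeasurable).2 ⟨?_, ?_⟩
    · exact Eventually.of_forall fun y' => ((hB (x - y')).1).smul (UnboundedOperators.heatKernel (t - s) y')
    · have hG := UnboundedOperators.integrable_heatKernel_holds (E := E) hts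
      refine (hG.mul_const B).mono' hHm.aestronglyMeasurable.norm.integral_prod_right'
        (Eventually.of_forall fun y' => ?_)
      have hGpos := (UnboundedOperators.heatKernel_pos hts y').le
      rw [Real.norm_of_nonneg (integral_nonneg fun p => norm_nonneg _)]
      calc ∫ p, ‖uncurry H (y', p)‖ ∂μ
          = ∫ p, UnboundedOperators.heatKernel (t - s) y' *
              ‖oseenKernel (s - p.1) (x - y' - p.2) (a p.1 p.2) (b p.1 p.2)‖ ∂μ := by
            refine integral_congr_ae (Eventually.of_forall fun p => ?_)
            simp only [uncurry, hH, norm_smul, Real.norm_of_nonneg hGpos]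
        _ = UnboundedOperators.heatKernel (t - s) y' *
              ∫ p, ‖oseenKernel (s - p.1) (x - y' - p.2) (a p.1 p.2) (b p.1 p.2)‖ ∂μ :=
            integral_const_mul _ _
        _ ≤ UnboundedOperators.heatKernel (t - s) y' * B := mul_le_mul_of_nonneg_left (hB (x - y')).2 hGpos
  -- a.e. in `p` the kernel time `s - τ` is positive
  have hpos : ∀ᵐ p ∂μ, p.1 ∈ Ioo s₀ s :=
    (Measure.quasiMeasurePreserving_fst (μ := (volume : Measure ℝ).restrict (Ioo s₀ s))
      (ν := (volume : Measure E))).ae (ae_restrict_mem measurableSet_Ioo)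
  -- the slab integral at time `t` as a product integral
  obtain ⟨B', -, hB'⟩ := exists_integrable_oseenKernel_slab_of_envelope ham hbm hst.le ha hb henv_t
  calc UnboundedOperators.heatExtension (oseenDuhamel 1 s₀ a b s) (t - s) x
      = ∫ y', UnboundedOperators.heatKernel (t - s) y' • oseenDuhamel 1 s₀ a b s (x - y') :=
        UnboundedOperators.heatExtension_apply _ _ _
    _ = ∫ y', ∫ p, H y' p ∂μ := by
        refine integral_congr_ae (Eventually.of_forall fun y' => ?_)
        simp only [hH, hD (x - y'), ← integral_smul]
    _ = ∫ p, (∫ y', H y' p) ∂μ := integral_integral_swap hHint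
    _ = ∫ p, oseenKernel (t - p.1) (x - p.2) (a p.1 p.2) (b p.1 p.2) ∂μ := by
        refine integral_congr_ae ?_
        filter_upwards [hpos] with p hp
        have hσ : 0 < s - p.1 := sub_pos.2 hp.2
        have h2 : ∀ y', H y' p = UnboundedOperators.heatKernel (t - s) y' •
            oseenKernel (s - p.1) (x - p.2 - y') (a p.1 p.2) (b p.1 p.2) := fun y' => by
          simp only [hH, sub_right_comm x y' p.2]
        rw [integral_congr_ae (Eventually.of_forall h2),
          integral_heatKernel_smul_oseenKernel_sub hσ hts (a p.1 p.2) (b p.1 p.2) (x - p.2)]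
        congr 1
        ring
    _ = ∫ τ in Ioo s₀ s, oseenSlice (t - τ) (a τ) (b τ) x := by
        rw [hμ, integral_prod _ (hB' x).1]
        refine setIntegral_congr_fun measurableSet_Ioo fun τ _ => ?_
        rw [oseenSlice_apply]

/-- **The restart law of the Duhamel term of a pair under an envelope**: with an envelope on
`(s₀, t)` such that `(s-τ)^{-1/2}M_aM_b` is integrable on `(s₀,s)` and `(t-τ)^{-1/2}M_aM_b` on
`(s₀,t)`, for `s₀ < s < t`,
`B¹_{s₀}(a,b)(t)(x) = e^{(t-s)Δ}[B¹_{s₀}(a,b)(s)](x) + B¹_s(a,b)(t)(x)` (KNSS 2009, §4 p. 8: the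
integral equation restarted from time `s`). [cite: KochNadirashviliSereginSverak2009, §4 p. 8 (arXiv:0709.3599)] -/
theorem oseenDuhamel_eq_heatExtension_add_of_envelope (ham : Measurable (uncurry a))
    (hbm : Measurable (uncurry b)) {s₀ s t : ℝ} (hs₀ : s₀ < s) (hst : s < t)
    (ha : ∀ τ ∈ Ioo s₀ t, ∀ y, ‖a τ y‖ ≤ Ma τ) (hb : ∀ τ ∈ Ioo s₀ t, ∀ y, ‖b τ y‖ ≤ Mb τ)
    (hm : AEStronglyMeasurable (fun τ => Ma τ * Mb τ) ((volume : Measure ℝ).restrict (Ioo s₀ s)))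
    (henv_s : IntegrableOn (fun τ => (s - τ) ^ (-(1 / 2 : ℝ)) * (Ma τ * Mb τ)) (Ioo s₀ s))
    (henv_t : IntegrableOn (fun τ => (t - τ) ^ (-(1 / 2 : ℝ)) * (Ma τ * Mb τ)) (Ioo s₀ t)) (x : E) :
    oseenDuhamel 1 s₀ a b t x =
      UnboundedOperators.heatExtension (oseenDuhamel 1 s₀ a b s) (t - s) x + oseenDuhamel 1 s a b t x := by
  have ha' : ∀ τ ∈ Ioo s₀ s, ∀ y, ‖a τ y‖ ≤ Ma τ := fun τ hτ => ha τ ⟨hτ.1, hτ.2.trans hst⟩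
  have hb' : ∀ τ ∈ Ioo s₀ s, ∀ y, ‖b τ y‖ ≤ Mb τ := fun τ hτ => hb τ ⟨hτ.1, hτ.2.trans hst⟩
  rw [heatExtension_oseenDuhamel_eq_setIntegral_of_envelope ham hbm hst ha' hb' hm henv_s x]
  have hsplit := oseenDuhamel_sub_oseenDuhamel_eq_setIntegral hs₀.le
    (integrableOn_oseenSlice_of_envelope ham hbm ha hb henv_t x)
  have hset : (Ioo s₀ t ∩ Iic s : Set ℝ) =ᵐ[volume] Ioo s₀ s := by
    refine (ae_eq_of_subset_of_subset_union_singleton (p := s) ?_ ?_).symm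
    · intro τ hτ
      exact ⟨⟨hτ.1, hτ.2.trans hst⟩, hτ.2.le⟩
    · intro τ hτ
      rcases (show τ ≤ s from hτ.2).lt_or_eq with h | h
      · exact Or.inl ⟨hτ.1.1, h⟩
      · exact Or.inr h
  rw [setIntegral_congr_set hset] at hsplit
  rw [← hsplit]
  abel

end Literature.Analysis.FluidPDE
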